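import Summits.Schanuel.Schanuel.Theses.RootDecomp1E

/-!
# RootDecomp1E — ROUND 7 glue «MultiplicationType» (lens 2, gen 7): `EStableDefectOne → PlainDefectOne → DefectOneSchanuel`

Port, for the census / prover seat, of `defectOneSplit_holds` of `HOME/decomp-schanuel-lens-2/g7/MultiplicationType.lean`:
proves the D-0019 glue item of the split of the shared weak piece `DefectOneSchanuel` (stmt-Schanuel-25020, S⁻ = «Schanuel
defect ≤ 1») by the MULTIPLICATION TYPE of the ℚ-span into `EStableDefectOne` (some irrational algebraic β multiplies
span_ℚ z into itself; first-failure-local) and `PlainDefectOne` (only rational algebraic multipliers; first-failure-local):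
strong induction on the length `n` discharges the sub-minimality hypothesis of both children below the first failure, then
excluded middle on the multiplication type.  No transcendence input; this file defines nothing (the LOCAL COPIES of the port are gone: the writer typed the split, items 31409/31410/31411).

Landed by the census seat (prover role) after the writer's round-7 edit of `Theses/RootDecomp1E.lean` (EStableDefectOne = stmt-Schanuel-31409,
PlainDefectOne = 31410, glue DefectOneSchanuelGlue = 31411 with binder order ES → Plain); critic CLEARED FOR TYPING 08:32:40Z.
-/

set_option linter.dupNamespace false

noncomputable section

namespace Summit.Schanuel.Schanuel.Theorems.RootDecomp1EDefectOneSplit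

open Summit.Schanuel.Schanuel.Theses.RootDecomp1E

/-- The glue in its natural binder order: first-failure induction + excluded middle on the multiplication type. -/
theorem defectOne_of_eStable_of_plain (hE : EStableDefectOne) (hP : PlainDefectOne) : DefectOneSchanuel := by
  intro n
  induction n using Nat.strong_induction_on with
  | _ n ih =>
    intro z hz
    have hsub : ∀ (m : ℕ) (w : Fin m → ℂ), m < n → LinearIndependent ℚ w →
        (∀ j, w j ∈ Submodule.span ℚ (Set.range z)) →
        (m : Cardinal) ≤ Algebra.trdeg ℚ
          ↥(IntermediateField.adjoin ℚ (Set.range w ∪ Set.range (Complex.exp ∘ w))) + 1 :=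
      fun m w hm hw _ => ih m hm w hw
    by_cases hst : ∃ β : ℂ, IsAlgebraic ℚ β ∧ β ∉ Set.range (algebraMap ℚ ℂ) ∧
        ∀ i, β * z i ∈ Submodule.span ℚ (Set.range z)
    · exact hE n z hz hst hsub
    · refine hP n z hz ?_ hsub
      intro β hβ hβV
      by_contra hq
      exact hst ⟨β, hβ, hq, hβV⟩

/-- Item (glue of the split of `DefectOneSchanuel`, round 7): holds.  (If the gate renders the children in the order
`PlainDefectOne → EStableDefectOne → DefectOneSchanuel`, write `defectOne_of_eStable_of_plain h₂ h₁`.) -/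
theorem defectOneSchanuelGlue_holds : DefectOneSchanuelGlue :=
  fun h₁ h₂ => defectOne_of_eStable_of_plain h₁ h₂

/-- Sanity: with the glue, the LIVE seven-binder `RootDecomp1E.closes` (rev 17) decides `Schanuel` from the two children
and the six other binders. -/
example (hES : EStableDefectOne) (hPl : PlainDefectOne) (hC : ClosedFormAtomSchanuel)
    (hAlg : AlgAnchoredDarkAtomSchanuel) (hLine : LineLogDarkAtomSchanuel) (hDeep : DeepLogDarkAtomSchanuel)
    (hOff : OffAxisClosure) (hF : FreeDarkAtomSchanuel) : _root_.Schanuel :=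
  closes (defectOne_of_eStable_of_plain hES hPl) hC hAlg hLine hDeep hOff hF

end Summit.Schanuel.Schanuel.Theorems.RootDecomp1EDefectOneSplit

end
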